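import Mathlib
import Summits.Ventures.HodgeRepro.Tier4.Common.AdelicDefs
import Summits.Ventures.HodgeRepro.Tier4.Common.AdelicPlaces
import Summits.Ventures.HodgeRepro.Tier4.Common.CongruenceAdeles
import Summits.Ventures.HodgeRepro.Tier4.Common.CompactOpenLevel
import Summits.Ventures.HodgeRepro.Tier4.Line1.PlaneDefs
import Summits.Ventures.HodgeRepro.Tier4.Line1.AdelicParts
import Summits.Ventures.HodgeRepro.Tier4.Line1.FiniteLevelIsolation
import Summits.Ventures.HodgeRepro.Tier4.Line4.FinitePlacePositivity
import Summits.Ventures.HodgeRepro.Tier4.Line4.TransporterLocal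
import Summits.Ventures.HodgeRepro.Tier4.Line4.TransporterDichotomy

/-!
# Tier4/Line4/TransporterSeparation — C-L4-TRANSPORTER-SEP: along `q^n` the level double coset of a regular
`γ₀` misses every transporter of `T` into `T′`

Blind re-derivation cell `pub-hodge-repro`, Tier 4 (README §9–§10), seat t4-L2-p3 (gen 4), cut C-L4-TRANSPORTER-SEP
(plan-4 g5 S15186 (2), crit-1 S15167 (3)(i), lead S15173; statement S15285).  Tree path
`lean/Summits/Ventures/HodgeRepro/Tier4/Line4/TransporterSeparation.lean`.

* the transporter hypothesis is L2-p1's term verbatim, `(torusT W).map (MulAut.conj γ⁻¹).toMonoidHom = torusT' W`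
  (`γ⁻¹ T γ = T′`, the complement of `SuppMeasureComparisonAlong`'s exclusion) — no new definition;
* **`exists_level_not_mem_levelDoubleCoset_of_transporter`** (the core, finite-part form): for a genuine row plane, a
  linearly regular rational `γ₀` and a prime `q` there is `n₁ = n₁(q, γ₀)` such that for `n ≥ n₁` no element of
  `G(𝔸)` with the finite part of a transporter (`y⁻¹ T y ⊆ T′`) lies in `K(q^n) γ₀,f K(q^n)`;
* `exists_level_separates_transporter` (the folded shape of `suppSetFolded`: `(t⁻¹ γ t′)_f`) and
  `exists_level_separates_transporter'` (the unfolded shape of `suppSet`: `b⁻¹ γ_f b′`).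

PROOF.  (1) `q` lies in a finite place `v` of `k`, so `ε := |q|_v < 1` (TransporterLocal §3).  (2) The rational
reflection `s₀ := P 0 − P 1` is a unitary element of `T(k)` (`GA.ofRationalMat`, `reflPt_mem_torusT`).  (3) RATIONAL DICHOTOMY: if
`γ₀⁻¹ P₀ γ₀` commuted with both `Q j`, `IsLinRegular` applied to `Y = adMat P₀`, `Y′ = γ₀⁻¹ Y γ₀` would make
`adMat P₀` an adelic `E′`-scalar `x·1 + y·Ω`; a `k`-linear functional vanishing on `span{1, Ω}` but not on `P₀`
(`P₀ ∉ span{1, Ω}` since `(a + bΩ)(a − bΩ) = (a² + d b²)·1` forces `P₀ = 0` or invertible, against `rank P₀ = 2`),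
extended `𝔸`-linearly, refutes this (`exists_commutator_ne_zero`); hence `[γ₀⁻¹ s₀ γ₀, Q j] ≠ 0` for some `j`
(`exists_reflMat_commutator_ne_zero`), also in `M₄(k_v)`.  (4) For `x = κ γ₀,f κ′` with `κ, κ′ ∈ K(q^n)` the
`v`-component of `x⁻¹ s₀ x` is `Φ(A, A⁻¹, C, C⁻¹) = C⁻¹ γ₀⁻¹ A⁻¹ s₀ A γ₀ C` with `A, A⁻¹, C, C⁻¹` entrywise within
`ε^n` of `1`; `[Φ, Q j]` is a continuous polynomial map with value `≠ 0` at `(1, 1, 1, 1)`, so `≠ 0` on the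
`ε^n`-box once `n ≥ n₁` (TransporterLocal §2).  (5) But `y⁻¹ s₀ y ∈ T′` commutes with `Q j`, and `x`, `y` have the
same `v`-component — contradiction.  No local line count, no split/inert distinction, no prime exclusion.
No printed input is consumed.  HC_CM is NOT proved by anyone in this repository.
-/

set_option autoImplicit false

noncomputable section

namespace Summit.Ventures.HodgeRepro.Tier4.Line4

open Summit.Ventures.HodgeRepro.Tier4 Summit.Ventures.HodgeRepro.Tier4.Common
  Summit.Ventures.HodgeRepro.Tier4.Line1
open NumberField IsDedekindDomain Topology Filter Matrix
open scoped NumberField Pointwise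

variable {k : Type} [Field k] [NumberField k] (W : PlaneData k)

/-! ### 1. The transporter -/

/-- **A transporter conjugates `T` into `T′`**: if `γ⁻¹ T γ = T′` (L2-p1's term, the complement of
`SuppMeasureComparisonAlong`'s exclusion) then `γ⁻¹ s γ ∈ T′` for every `s ∈ T`. -/
theorem conj_mem_torusT'_of_map_eq {γ : GA W}
    (h : (torusT W).map (MulAut.conj γ⁻¹).toMonoidHom = torusT' W) {s : GA W} (hs : s ∈ torusT W) :
    γ⁻¹ * s * γ ∈ torusT' W := by
  rw [← h]
  exact Subgroup.mem_map.2 ⟨s, hs, by simp⟩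

/-! ### 5. The separation theorem -/

/-- **The local commutator estimate**: if `[G′ S G, Q] ≠ 0` then `[C′ G′ A′ S A G C, Q] ≠ 0` whenever
`A, A′, C, C′` are entrywise within `ε ^ n` of `1`, for all `n ≥ n₀`. -/
theorem exists_nat_commutator_ne_zero_of_near (v : HeightOneSpectrum (𝓞 k)) {ε : WithZero (Multiplicative ℤ)}
    (hε0 : ε ≠ 0) (hε1 : ε < 1) (G G' S Q : Matrix (Fin 4) (Fin 4) (v.adicCompletion k))
    (h1 : (G' * S * G) * Q - Q * (G' * S * G) ≠ 0) :
    ∃ n₀ : ℕ, ∀ n ≥ n₀, ∀ A A' C C' : Matrix (Fin 4) (Fin 4) (v.adicCompletion k),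
      (∀ i j, Valued.v (A i j - (1 : Matrix (Fin 4) (Fin 4) (v.adicCompletion k)) i j) ≤ ε ^ n) →
      (∀ i j, Valued.v (A' i j - (1 : Matrix (Fin 4) (Fin 4) (v.adicCompletion k)) i j) ≤ ε ^ n) →
      (∀ i j, Valued.v (C i j - (1 : Matrix (Fin 4) (Fin 4) (v.adicCompletion k)) i j) ≤ ε ^ n) →
      (∀ i j, Valued.v (C' i j - (1 : Matrix (Fin 4) (Fin 4) (v.adicCompletion k)) i j) ≤ ε ^ n) →
      (C' * G' * A' * S * A * G * C) * Q - Q * (C' * G' * A' * S * A * G * C) ≠ 0 := by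
  let Φ : (Fin 4 → Matrix (Fin 4) (Fin 4) (v.adicCompletion k)) → Matrix (Fin 4) (Fin 4) (v.adicCompletion k) :=
    fun p => (p 3 * G' * p 1 * S * p 0 * G * p 2) * Q - Q * (p 3 * G' * p 1 * S * p 0 * G * p 2)
  have hbig : Continuous fun p : Fin 4 → Matrix (Fin 4) (Fin 4) (v.adicCompletion k) =>
      p 3 * G' * p 1 * S * p 0 * G * p 2 :=
    ((((((continuous_apply 3).matrix_mul continuous_const).matrix_mul (continuous_apply 1)).matrix_mul
      continuous_const).matrix_mul (continuous_apply 0)).matrix_mul continuous_const).matrix_mul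
      (continuous_apply 2)
  have hΦc : Continuous Φ := (hbig.matrix_mul continuous_const).sub (continuous_const.matrix_mul hbig)
  have hΦ1 : Φ (fun _ => 1) ≠ 0 := by
    show (1 * G' * 1 * S * 1 * G * 1) * Q - Q * (1 * G' * 1 * S * 1 * G * 1) ≠ 0
    simpa only [one_mul, mul_one] using h1
  obtain ⟨n₀, hn₀⟩ := exists_nat_ne_zero_of_nearQuad v hε0 hε1 Φ hΦc hΦ1
  refine ⟨n₀, fun n hn A A' C C' hA hA' hC hC' => ?_⟩
  have hp := hn₀ n hn ![A, A', C, C'] (fun l => by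
    fin_cases l
    · exact hA
    · exact hA'
    · exact hC
    · exact hC')
  exact hp

/-- **C-L4-TRANSPORTER-SEP, core form.**  For a genuine row plane, a linearly regular rational `γ₀` and a prime
`q` there is `n₁` (depending on `q, γ₀` only) such that for every `n ≥ n₁`: no `x ∈ G(𝔸)` having the finite part of
an element `y` that conjugates `T` into `T′` lies in `K(q^n) γ₀,f K(q^n)`. -/
theorem exists_level_not_mem_levelDoubleCoset_of_transporter (hg : IsGenuineRow W) (γ₀ : rationalPoints W)
    (hreg : IsLinRegular W γ₀) (q : ℕ) (hq : q.Prime) :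
    ∃ n₁ : ℕ, ∀ n ≥ n₁, ∀ x y : GA W, finM k (GA.mat W x) = finM k (GA.mat W y) →
      (∀ s ∈ torusT W, y⁻¹ * s * y ∈ torusT' W) →
      x ∉ levelDoubleCoset W (q ^ n) (GA.ofFinPart W (γ₀ : GA W)) := by
  obtain ⟨v, hv⟩ := exists_heightOneSpectrum_natCast_mem k q hq
  have hε0 : natSize k v q ≠ 0 := natSize_ne_zero k v hq.ne_zero
  have hε1 : natSize k v q < 1 := natSize_lt_one_of_mem k v hv
  obtain ⟨u, hu, hu'⟩ := exists_rational_gl W γ₀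
  obtain ⟨j, hj⟩ := exists_reflMat_commutator_ne_zero W hg γ₀ hreg u hu
  have hPB : ∀ i, W.P i * W.B = W.B * (W.P i)ᵀ := hg.2.2.1
  obtain ⟨S₀, hS₀⟩ : ∃ S₀ : GA W,
      S₀ = GA.ofRationalMat W (W.P 0 - W.P 1) (reflMat_det_ne_zero W) (reflMat_comm_Ω W) (reflMat_form W hPB) :=
    ⟨_, rfl⟩
  have hS₀T : S₀ ∈ torusT W := hS₀ ▸ reflPt_mem_torusT W hPB
  have hS₀mat : GA.mat W S₀ = adMat k (W.P 0 - W.P 1) := hS₀ ▸ mat_reflPt W hPB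
  -- the local matrices
  have hρinj : Function.Injective ((algebraMap k (v.adicCompletion k)).mapMatrix :
      Matrix (Fin 4) (Fin 4) k →+* Matrix (Fin 4) (Fin 4) (v.adicCompletion k)) := by
    intro A B h
    ext i j
    exact (algebraMap k (v.adicCompletion k)).injective (congrFun (congrFun h i) j)
  have hφm : ∀ g : GA W, (adComponentFin k v).mapMatrix (GA.mat W g) =
      ((GA.finiteComponent W v g : GL (Fin 4) (v.adicCompletion k)) :
        Matrix (Fin 4) (Fin 4) (v.adicCompletion k)) := by
    intro g
    ext i j
    rfl
  have hρA : ∀ A : Matrix (Fin 4) (Fin 4) k, (adComponentFin k v).mapMatrix (adMat k A) =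
      (algebraMap k (v.adicCompletion k)).mapMatrix A := by
    intro A
    ext i j
    rfl
  obtain ⟨Gv, hGv⟩ : ∃ M, M = (algebraMap k (v.adicCompletion k)).mapMatrix (u : Matrix (Fin 4) (Fin 4) k) :=
    ⟨_, rfl⟩
  obtain ⟨G'v, hG'v⟩ : ∃ M, M = (algebraMap k (v.adicCompletion k)).mapMatrix
      ((u⁻¹ : GL (Fin 4) k) : Matrix (Fin 4) (Fin 4) k) := ⟨_, rfl⟩
  obtain ⟨Sv, hSv⟩ : ∃ M, M = (algebraMap k (v.adicCompletion k)).mapMatrix (W.P 0 - W.P 1) := ⟨_, rfl⟩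
  obtain ⟨Qv, hQv⟩ : ∃ M, M = (algebraMap k (v.adicCompletion k)).mapMatrix (W.Q j) := ⟨_, rfl⟩
  have h1 : (G'v * Sv * Gv) * Qv - Qv * (G'v * Sv * Gv) ≠ 0 := by
    intro h0
    apply hj
    apply hρinj
    rw [map_mul, map_mul, map_mul, map_mul, map_mul, map_mul, ← hGv, ← hG'v, ← hSv, ← hQv]
    exact sub_eq_zero.1 h0
  obtain ⟨n₀, hn₀⟩ := exists_nat_commutator_ne_zero_of_near v hε0 hε1 Gv G'v Sv Qv h1
  refine ⟨n₀, fun n hn x y hxy hy hx => ?_⟩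
  obtain ⟨a, ha, c, hc, hxe⟩ :=
    exists_eq_mul_of_mem_mul_singleton_mul W (levelK W (q ^ n) : Set (GA W)) _ x hx
  have ha' : a ∈ levelK W (q ^ n) := SetLike.mem_coe.1 ha
  have hc' : c ∈ levelK W (q ^ n) := SetLike.mem_coe.1 hc
  have hφx : GA.finiteComponent W v x =
      GA.finiteComponent W v a * GA.finiteComponent W v (γ₀ : GA W) * GA.finiteComponent W v c := by
    rw [hxe, map_mul, map_mul, finiteComponent_ofFinPart]
  have hφy : GA.finiteComponent W v y = GA.finiteComponent W v x := (finiteComponent_eq_of_finM_eq W v hxy).symm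
  -- the transporter identity at the reflection, read at `v`
  have hT : y⁻¹ * S₀ * y ∈ torusT' W := hy _ hS₀T
  have hcommQ : ∀ i : Fin 2, GA.mat W (y⁻¹ * S₀ * y) * adMat k (W.Q i) =
      adMat k (W.Q i) * GA.mat W (y⁻¹ * S₀ * y) :=
    Fin.forall_fin_two.2 ⟨(Subgroup.mem_inf.1 hT).1, (Subgroup.mem_inf.1 hT).2⟩
  have hcv := congrArg (adComponentFin k v).mapMatrix (hcommQ j)
  rw [map_mul, map_mul, hρA, hφm, ← hQv] at hcv
  have hφS : GA.finiteComponent W v (y⁻¹ * S₀ * y) =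
      GA.finiteComponent W v c⁻¹ * GA.finiteComponent W v ((γ₀ : GA W)⁻¹) * GA.finiteComponent W v a⁻¹ *
        GA.finiteComponent W v (S₀) * GA.finiteComponent W v a * GA.finiteComponent W v (γ₀ : GA W) *
        GA.finiteComponent W v c := by
    rw [map_mul, map_mul, map_inv, hφy, hφx, _root_.mul_inv_rev, _root_.mul_inv_rev, map_inv, map_inv, map_inv]
    simp only [mul_assoc]
  have hGv' : ((GA.finiteComponent W v (γ₀ : GA W) : GL (Fin 4) (v.adicCompletion k)) :
      Matrix (Fin 4) (Fin 4) (v.adicCompletion k)) = Gv := by rw [← hφm, hu, hρA, hGv]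
  have hG'v' : ((GA.finiteComponent W v ((γ₀ : GA W)⁻¹) : GL (Fin 4) (v.adicCompletion k)) :
      Matrix (Fin 4) (Fin 4) (v.adicCompletion k)) = G'v := by rw [← hφm, hu', hρA, hG'v]
  have hSv' : ((GA.finiteComponent W v (S₀) : GL (Fin 4) (v.adicCompletion k)) :
      Matrix (Fin 4) (Fin 4) (v.adicCompletion k)) = Sv := by rw [← hφm, hS₀mat, hρA, hSv]
  have hbig : ((GA.finiteComponent W v (y⁻¹ * S₀ * y) : GL (Fin 4) (v.adicCompletion k)) :
      Matrix (Fin 4) (Fin 4) (v.adicCompletion k)) =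
      ((GA.finiteComponent W v c⁻¹ : GL (Fin 4) (v.adicCompletion k)) : Matrix (Fin 4) (Fin 4) (v.adicCompletion k)) *
        G'v * ((GA.finiteComponent W v a⁻¹ : GL (Fin 4) (v.adicCompletion k)) :
          Matrix (Fin 4) (Fin 4) (v.adicCompletion k)) * Sv *
        ((GA.finiteComponent W v a : GL (Fin 4) (v.adicCompletion k)) : Matrix (Fin 4) (Fin 4) (v.adicCompletion k)) *
        Gv * ((GA.finiteComponent W v c : GL (Fin 4) (v.adicCompletion k)) :
          Matrix (Fin 4) (Fin 4) (v.adicCompletion k)) := by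
    rw [hφS, Units.val_mul, Units.val_mul, Units.val_mul, Units.val_mul, Units.val_mul, Units.val_mul, hGv', hG'v',
      hSv']
  rw [hbig] at hcv
  have hnear : ∀ g ∈ levelK W (q ^ n), ∀ i j : Fin 4, Valued.v
      (((GA.finiteComponent W v g : GL (Fin 4) (v.adicCompletion k)) : Matrix (Fin 4) (Fin 4) (v.adicCompletion k)) i j -
        (1 : Matrix (Fin 4) (Fin 4) (v.adicCompletion k)) i j) ≤ natSize k v q ^ n := by
    intro g hg i j
    rw [← natSize_pow]
    exact nearMat_finiteComponent_of_mem_levelK W v hg i j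
  exact hn₀ n hn _ _ _ _ (hnear a ha') (hnear a⁻¹ ((levelK W (q ^ n)).inv_mem ha')) (hnear c hc')
    (hnear c⁻¹ ((levelK W (q ^ n)).inv_mem hc')) (sub_eq_zero.2 hcv)

/-- **C-L4-TRANSPORTER-SEP (folded shape, `suppSetFolded`)**: for `n ≥ n₁(q, γ₀)`, a transporter `γ` and any
`t ∈ T`, `t′ ∈ T′`, the finite part of `t⁻¹ γ t′` is outside `K(q^n) γ₀,f K(q^n)`. -/
theorem exists_level_separates_transporter (hg : IsGenuineRow W) (γ₀ : rationalPoints W)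
    (hreg : IsLinRegular W γ₀) (q : ℕ) (hq : q.Prime) :
    ∃ n₁ : ℕ, ∀ n ≥ n₁, ∀ γ : rationalPoints W,
      (torusT W).map (MulAut.conj ((γ : GA W))⁻¹).toMonoidHom = torusT' W →
      ∀ t ∈ torusT W, ∀ t' ∈ torusT' W,
        GA.ofFinPart W (t⁻¹ * (γ : GA W) * t') ∉ levelDoubleCoset W (q ^ n) (GA.ofFinPart W (γ₀ : GA W)) := by
  obtain ⟨n₁, hn₁⟩ := exists_level_not_mem_levelDoubleCoset_of_transporter W hg γ₀ hreg q hq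
  refine ⟨n₁, fun n hn γ hγ t ht t' ht' => hn₁ n hn _ (t⁻¹ * (γ : GA W) * t') (finM_mat_ofFinPart_eq W _) ?_⟩
  intro s hs
  have h1 : t * s * t⁻¹ ∈ torusT W := mul_mem (mul_mem ht hs) (inv_mem ht)
  have h2 : (γ : GA W)⁻¹ * (t * s * t⁻¹) * γ ∈ torusT' W := conj_mem_torusT'_of_map_eq W hγ h1
  have h3 : t'⁻¹ * ((γ : GA W)⁻¹ * (t * s * t⁻¹) * γ) * t' ∈ torusT' W := mul_mem (mul_mem (inv_mem ht') h2) ht'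
  have he : (t⁻¹ * (γ : GA W) * t')⁻¹ * s * (t⁻¹ * (γ : GA W) * t') =
      t'⁻¹ * ((γ : GA W)⁻¹ * (t * s * t⁻¹) * γ) * t' := by
    group
  rw [he]
  exact h3

/-- **C-L4-TRANSPORTER-SEP (unfolded shape, L2-p1's `suppSet`)**: for `n ≥ n₁(q, γ₀)`, a transporter `γ` and any
`b ∈ T`, `b′ ∈ T′`, `b⁻¹ γ_f b′` is outside `K(q^n) γ₀,f K(q^n)`. -/
theorem exists_level_separates_transporter' (hg : IsGenuineRow W) (γ₀ : rationalPoints W)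
    (hreg : IsLinRegular W γ₀) (q : ℕ) (hq : q.Prime) :
    ∃ n₁ : ℕ, ∀ n ≥ n₁, ∀ γ : rationalPoints W,
      (torusT W).map (MulAut.conj ((γ : GA W))⁻¹).toMonoidHom = torusT' W →
      ∀ (b : torusT W) (b' : torusT' W),
        (b : GA W)⁻¹ * GA.ofFinPart W (γ : GA W) * (b' : GA W) ∉
          levelDoubleCoset W (q ^ n) (GA.ofFinPart W (γ₀ : GA W)) := by
  obtain ⟨n₁, hn₁⟩ := exists_level_not_mem_levelDoubleCoset_of_transporter W hg γ₀ hreg q hq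
  refine ⟨n₁, fun n hn γ hγ b b' => hn₁ n hn _ ((b : GA W)⁻¹ * (γ : GA W) * b') ?_ ?_⟩
  · rw [GA.mat_mul, GA.mat_mul, GA.mat_mul, GA.mat_mul, finM_mul, finM_mul, finM_mul, finM_mul,
      finM_mat_ofFinPart_eq]
  · intro s hs
    have h1 : (b : GA W) * s * (b : GA W)⁻¹ ∈ torusT W := mul_mem (mul_mem b.2 hs) (inv_mem b.2)
    have h2 : (γ : GA W)⁻¹ * ((b : GA W) * s * (b : GA W)⁻¹) * γ ∈ torusT' W := conj_mem_torusT'_of_map_eq W hγ h1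
    have h3 : (b' : GA W)⁻¹ * ((γ : GA W)⁻¹ * ((b : GA W) * s * (b : GA W)⁻¹) * γ) * b' ∈ torusT' W :=
      mul_mem (mul_mem (inv_mem b'.2) h2) b'.2
    have he : ((b : GA W)⁻¹ * (γ : GA W) * b')⁻¹ * s * ((b : GA W)⁻¹ * (γ : GA W) * b') =
        (b' : GA W)⁻¹ * ((γ : GA W)⁻¹ * ((b : GA W) * s * (b : GA W)⁻¹) * γ) * b' := by
      group
    rw [he]
    exact h3

end Summit.Ventures.HodgeRepro.Tier4.Line4

end
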